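import Literature.NumberTheory.Transcendental.KZCubicalCalculus
import Literature.NumberTheory.Transcendental.NashCubes
import Literature.NumberTheory.Transcendental.SemialgebraicLineDeriv
import Literature.NumberTheory.Transcendental.Associators

/-!
# `PentagonInKZ`, line `edge-normal-newton-leibniz`: corner engine — admissibility of the data of Step A

Part of the proof of `cornerEngine_uniformlyNull` (crux `FurushoPentagon.PentagonInKZ`,
stmt-KontsevichZagierPeriods-11348), in the ABSTRACT form of the corner engine: all objects (residues `Zq`,
residue monomials `wZ`, letter densities `fd`, `gd`, `dd`, regularised word integrands `Ht`, `Vt`,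
`dHt`, `dVt`, insertion operators `op`, `opV`, transports `Af`, `Bf`, `dAf`, `dBf`, defect `F`,
coordinate blocks `Xb | Yb | Θb`) are hypothesised, and their properties form ONE hypothesis
bundle `H`.  This file checks the ADMISSIBILITY of the data induced by Step A of the engine at the
parameter levels `e + 1` (`Ξ₁ = Ξ(θ₀) s`, `Η₁ = Η(θ₀)`, weights `σ_a = σ Ξ (θ₀) fd_a(Ξ₁, Η₁)`) and
`e + 2` (`Ξ₂ = Ξ(θ₀) s`, `Η₂ = Η(θ₀) s'`, `ρ₂ = σ Ξ Η (θ₀)`, weights `ρ₂ dd_c`, `ρ₂ fd_a gd_b`):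

* `init_mem_cube`, `sa_init`, `sa_coord_cube` — `Fin.init` of a cube point is a cube point, and
  semialgebraic functions of it (and the coordinates) are semialgebraic;
* `abs_fd_mul_le`, `abs_gd_mul_le` — `|fd a (t, y)| t` and `|gd b (x, s)| s` are bounded on the
  rectangle (the regularised letters carry `1/t`, `1/s`); `abs_rho2_le` — `|ρ₂| ≤ C₀`;
* `exists_stepA_adm` — semialgebraicity, ranges and admissibility bounds of the induced data.

References: [KontsevichZagier2001, §1.1–1.2], [BochnakCosteRoy1998, Prop. 2.2.6], [Drinfeld1991, §2].
-/

noncomputable section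

open Set MeasureTheory
open Literature.NumberTheory.Transcendental
open Literature.ModelTheory.ExponentialFields (IsSemialgebraic)

namespace Summit.KontsevichZagierPeriods.FurushoPentagon.PentagonInKZ

section AbstractEngine

variable {m N : ℕ} {ℓ ℓ' : Fin (m + 2)} {α β : ℚ}
  {Zq : Fin (m + 2) → (DrinfeldKohnoTrunc ℚ (Fin 4) N)} {wZ : ∀ {n : ℕ}, (Fin n → Fin (m + 2)) → (DrinfeldKohnoTrunc ℚ (Fin 4) N)}
  {fd gd dd : Fin (m + 2) → ℝ → ℝ → ℝ}
  {Ht Vt dHt dVt : ∀ {n : ℕ}, (Fin n → Fin (m + 2)) → (Fin n → ℝ) → ℝ → ℝ → ℝ}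
  {op opV : Fin (m + 2) → (DrinfeldKohnoTrunc ℚ (Fin 4) N) →ₗ[ℚ] (DrinfeldKohnoTrunc ℚ (Fin 4) N)}
  {Af Bf dAf dBf F : ((DrinfeldKohnoTrunc ℚ (Fin 4) N) →ₗ[ℚ] ℚ) → ∀ {k l : ℕ}, (Fin k → ℝ) → (Fin l → ℝ) → ℝ → ℝ → ℝ}
  {Xb : ∀ k l e : ℕ, (Fin (k + l + e) → ℝ) → Fin k → ℝ}
  {Yb : ∀ k l e : ℕ, (Fin (k + l + e) → ℝ) → Fin l → ℝ}
  {Θb : ∀ k l e : ℕ, (Fin (k + l + e) → ℝ) → Fin e → ℝ}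

variable (H :
    (∀ {n : ℕ} (U : Fin n → Fin (m + 2)), wZ U = ((List.ofFn U).map Zq).prod) ∧
    (∀ (a : Fin (m + 2)) (X : (DrinfeldKohnoTrunc ℚ (Fin 4) N)), op a X = if a = ℓ then Zq ℓ * X - X * Zq ℓ else Zq a * X) ∧
    (∀ (b : Fin (m + 2)) (X : (DrinfeldKohnoTrunc ℚ (Fin 4) N)), opV b X = if b = ℓ' then Zq ℓ' * X - X * Zq ℓ' else Zq b * X) ∧
    (∀ (μ : (DrinfeldKohnoTrunc ℚ (Fin 4) N) →ₗ[ℚ] ℚ) {k l : ℕ} (x : Fin k → ℝ) (y : Fin l → ℝ) (ξ η : ℝ), Af μ x y ξ η = ∑ U : Fin k → Fin (m + 2), ∑ V : Fin l → Fin (m + 2), (μ (wZ U * wZ V) : ℝ) * (Ht U x ξ η * Vt V y 0 η)) ∧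
    (∀ (μ : (DrinfeldKohnoTrunc ℚ (Fin 4) N) →ₗ[ℚ] ℚ) {k l : ℕ} (x : Fin k → ℝ) (y : Fin l → ℝ) (ξ η : ℝ), Bf μ x y ξ η = ∑ U : Fin k → Fin (m + 2), ∑ V : Fin l → Fin (m + 2), (μ (wZ V * wZ U) : ℝ) * (Vt V y ξ η * Ht U x ξ 0)) ∧
    (∀ (μ : (DrinfeldKohnoTrunc ℚ (Fin 4) N) →ₗ[ℚ] ℚ) {k l : ℕ} (x : Fin k → ℝ) (y : Fin l → ℝ) (ξ η : ℝ), dAf μ x y ξ η = ∑ U : Fin k → Fin (m + 2), ∑ V : Fin l → Fin (m + 2), (μ (wZ U * wZ V) : ℝ) * (dHt U x ξ η * Vt V y 0 η)) ∧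
    (∀ (μ : (DrinfeldKohnoTrunc ℚ (Fin 4) N) →ₗ[ℚ] ℚ) {k l : ℕ} (x : Fin k → ℝ) (y : Fin l → ℝ) (ξ η : ℝ), dBf μ x y ξ η = ∑ U : Fin k → Fin (m + 2), ∑ V : Fin l → Fin (m + 2), (μ (wZ V * wZ U) : ℝ) * (dVt V y ξ η * Ht U x ξ 0)) ∧
    (∀ (μ : (DrinfeldKohnoTrunc ℚ (Fin 4) N) →ₗ[ℚ] ℚ) {k l : ℕ} (x : Fin k → ℝ) (y : Fin l → ℝ) (ξ η : ℝ), F μ x y ξ η = Af μ x y ξ η - Bf μ x y ξ η) ∧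
    (∀ (k l e : ℕ) (z : Fin (k + l + e) → ℝ), Xb k l e z = fun i => z (Fin.castAdd e (Fin.castAdd l i))) ∧
    (∀ (k l e : ℕ) (z : Fin (k + l + e) → ℝ), Yb k l e z = fun j => z (Fin.castAdd e (Fin.natAdd k j))) ∧
    (∀ (k l e : ℕ) (z : Fin (k + l + e) → ℝ), Θb k l e z = fun s => z (Fin.natAdd (k + l) s)) ∧
    (∀ (U : Fin 0 → Fin (m + 2)) (x : Fin 0 → ℝ) (ξ η : ℝ), Ht U x ξ η = 1) ∧
    (∀ (V : Fin 0 → Fin (m + 2)) (y : Fin 0 → ℝ) (ξ η : ℝ), Vt V y ξ η = 1) ∧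
    (∀ (U : Fin 0 → Fin (m + 2)) (x : Fin 0 → ℝ) (ξ η : ℝ), dHt U x ξ η = 0) ∧
    (∀ (V : Fin 0 → Fin (m + 2)) (y : Fin 0 → ℝ) (ξ η : ℝ), dVt V y ξ η = 0) ∧
    (∀ {k : ℕ} (U : Fin (k + 1) → Fin (m + 2)) (x : Fin (k + 1) → ℝ) (η : ℝ), Ht U x 0 η = 0) ∧
    (∀ {l : ℕ} (V : Fin (l + 1) → Fin (m + 2)) (y : Fin (l + 1) → ℝ) (ξ : ℝ), Vt V y ξ 0 = 0) ∧
    (∀ t y : ℝ, fd ℓ t y = 1 / t) ∧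
    (∀ x s : ℝ, gd ℓ' x s = 1 / s) ∧
    (∀ x y : ℝ, dd ℓ x y = 0) ∧
    (∀ x y : ℝ, dd ℓ' x y = 0) ∧
    (∀ (μ : (DrinfeldKohnoTrunc ℚ (Fin 4) N) →ₗ[ℚ] ℚ) {k : ℕ} (x₀ : ℝ) (x' : Fin k → ℝ) (ξ η : ℝ), ∑ U : Fin (k + 1) → Fin (m + 2), (μ (wZ U) : ℝ) * Ht U (Fin.cons x₀ x') ξ η = (∑ a : Fin (m + 2), (if a = ℓ then 1 / x₀ else ξ * fd a (ξ * x₀) η) * ∑ U' : Fin k → Fin (m + 2), (μ (Zq a * wZ U') : ℝ) * Ht U' x' (ξ * x₀) η) - (1 / x₀) * ∑ U' : Fin k → Fin (m + 2), (μ (wZ U' * Zq ℓ) : ℝ) * Ht U' x' (ξ * x₀) η) ∧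
    (∀ (μ : (DrinfeldKohnoTrunc ℚ (Fin 4) N) →ₗ[ℚ] ℚ) {l : ℕ} (y₀ : ℝ) (y' : Fin l → ℝ) (ξ η : ℝ), ∑ V : Fin (l + 1) → Fin (m + 2), (μ (wZ V) : ℝ) * Vt V (Fin.cons y₀ y') ξ η = (∑ b : Fin (m + 2), (if b = ℓ' then 1 / y₀ else η * gd b ξ (η * y₀)) * ∑ V' : Fin l → Fin (m + 2), (μ (Zq b * wZ V') : ℝ) * Vt V' y' ξ (η * y₀)) - (1 / y₀) * ∑ V' : Fin l → Fin (m + 2), (μ (wZ V' * Zq ℓ') : ℝ) * Vt V' y' ξ (η * y₀)) ∧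
    (∀ (μ : (DrinfeldKohnoTrunc ℚ (Fin 4) N) →ₗ[ℚ] ℚ) {l : ℕ} (P Q : (DrinfeldKohnoTrunc ℚ (Fin 4) N)) (y : Fin l → ℝ) (η : ℝ), (∀ i, 0 < y i ∧ y i < 1) → 0 < η → η ≤ (β : ℝ) → ∑ V : Fin l → Fin (m + 2), (μ (P * (Zq ℓ * wZ V - wZ V * Zq ℓ) * Q) : ℝ) * Vt V y 0 η = 0) ∧
    (∀ (μ : (DrinfeldKohnoTrunc ℚ (Fin 4) N) →ₗ[ℚ] ℚ) {k : ℕ} (P Q : (DrinfeldKohnoTrunc ℚ (Fin 4) N)) (x : Fin k → ℝ) (ξ : ℝ), (∀ i, 0 < x i ∧ x i < 1) → 0 < ξ → ξ ≤ (α : ℝ) → ∑ U : Fin k → Fin (m + 2), (μ (P * (Zq ℓ' * wZ U - wZ U * Zq ℓ') * Q) : ℝ) * Ht U x ξ 0 = 0) ∧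
    (∀ (μ : (DrinfeldKohnoTrunc ℚ (Fin 4) N) →ₗ[ℚ] ℚ) (P Q : (DrinfeldKohnoTrunc ℚ (Fin 4) N)), μ (P * (Zq ℓ * Zq ℓ' - Zq ℓ' * Zq ℓ) * Q) = 0) ∧
    (∀ (μ : (DrinfeldKohnoTrunc ℚ (Fin 4) N) →ₗ[ℚ] ℚ) (P Q : (DrinfeldKohnoTrunc ℚ (Fin 4) N)) (x y : ℝ), 0 < x → x < (α : ℝ) → 0 < y → y < (β : ℝ) → ∑ a : Fin (m + 2), ∑ b : Fin (m + 2), (fd a x y * gd b x y) * (μ (P * (Zq a * Zq b - Zq b * Zq a) * Q) : ℝ) = 0) ∧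
    (∀ (μ : (DrinfeldKohnoTrunc ℚ (Fin 4) N) →ₗ[ℚ] ℚ) (P Q : (DrinfeldKohnoTrunc ℚ (Fin 4) N)) (s : ℝ), 0 < s → s < (β : ℝ) → ∑ b : Fin (m + 2), gd b 0 s * (μ (P * (Zq ℓ * Zq b - Zq b * Zq ℓ) * Q) : ℝ) = 0) ∧
    (∀ (μ : (DrinfeldKohnoTrunc ℚ (Fin 4) N) →ₗ[ℚ] ℚ) (P Q : (DrinfeldKohnoTrunc ℚ (Fin 4) N)) (t : ℝ), 0 < t → t < (α : ℝ) → ∑ a : Fin (m + 2), fd a t 0 * (μ (P * (Zq ℓ' * Zq a - Zq a * Zq ℓ') * Q) : ℝ) = 0) ∧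
    (∀ (a : Fin (m + 2)) (ξ η : ℝ), 0 ≤ ξ → ξ ≤ (α : ℝ) → 0 ≤ η → η ≤ (β : ℝ) → HasDerivAt (fun y => fd a ξ y) (dd a ξ η) η) ∧
    (∀ (b : Fin (m + 2)) (ξ η : ℝ), 0 ≤ ξ → ξ ≤ (α : ℝ) → 0 ≤ η → η ≤ (β : ℝ) → HasDerivAt (fun x => gd b x η) (dd b ξ η) ξ) ∧
    (∀ {k : ℕ} (U : Fin k → Fin (m + 2)) (x : Fin k → ℝ) (ξ η : ℝ), (∀ i, 0 ≤ x i ∧ x i ≤ 1) → 0 ≤ ξ → ξ ≤ (α : ℝ) → 0 ≤ η → η ≤ (β : ℝ) → HasDerivAt (fun t => Ht U x t η) (dHt U x ξ η) ξ) ∧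
    (∀ {l : ℕ} (V : Fin l → Fin (m + 2)) (y : Fin l → ℝ) (ξ η : ℝ), (∀ i, 0 ≤ y i ∧ y i ≤ 1) → 0 ≤ ξ → ξ ≤ (α : ℝ) → 0 ≤ η → η ≤ (β : ℝ) → HasDerivAt (fun s => Vt V y ξ s) (dVt V y ξ η) η) ∧
    (∀ {k : ℕ} (U : Fin (k + 1) → Fin (m + 2)) (x₀ : ℝ) (x' : Fin k → ℝ) (ξ η : ℝ), 0 < x₀ → x₀ < 1 → (∀ i, 0 ≤ x' i ∧ x' i ≤ 1) → 0 ≤ ξ → ξ ≤ (α : ℝ) → 0 ≤ η → η ≤ (β : ℝ) → HasDerivAt (fun t => t * Ht U (Fin.cons t x') ξ η) (ξ * dHt U (Fin.cons x₀ x') ξ η) x₀) ∧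
    (∀ {l : ℕ} (V : Fin (l + 1) → Fin (m + 2)) (y₀ : ℝ) (y' : Fin l → ℝ) (ξ η : ℝ), 0 < y₀ → y₀ < 1 → (∀ i, 0 ≤ y' i ∧ y' i ≤ 1) → 0 ≤ ξ → ξ ≤ (α : ℝ) → 0 ≤ η → η ≤ (β : ℝ) → HasDerivAt (fun t => t * Vt V (Fin.cons t y') ξ η) (η * dVt V (Fin.cons y₀ y') ξ η) y₀) ∧
    (∀ {k : ℕ} (U : Fin (k + 1) → Fin (m + 2)) (x' : Fin k → ℝ) (ξ η : ℝ), (∀ i, 0 ≤ x' i ∧ x' i ≤ 1) → 0 ≤ ξ → ξ ≤ (α : ℝ) → 0 ≤ η → η ≤ (β : ℝ) → ContinuousOn (fun t => t * Ht U (Fin.cons t x') ξ η) (Set.Icc 0 1)) ∧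
    (∀ {l : ℕ} (V : Fin (l + 1) → Fin (m + 2)) (y' : Fin l → ℝ) (ξ η : ℝ), (∀ i, 0 ≤ y' i ∧ y' i ≤ 1) → 0 ≤ ξ → ξ ≤ (α : ℝ) → 0 ≤ η → η ≤ (β : ℝ) → ContinuousOn (fun t => t * Vt V (Fin.cons t y') ξ η) (Set.Icc 0 1)) ∧
    (∀ {d : ℕ} {W : Set (Fin d → ℝ)}, IsSemialgebraic ℚ W → ∀ (a : Fin (m + 2)) {T Y : (Fin d → ℝ) → ℝ}, IsSemialgebraicFunOn ℚ W T → IsSemialgebraicFunOn ℚ W Y → IsSemialgebraicFunOn ℚ W fun z => fd a (T z) (Y z)) ∧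
    (∀ {d : ℕ} {W : Set (Fin d → ℝ)}, IsSemialgebraic ℚ W → ∀ (b : Fin (m + 2)) {T Y : (Fin d → ℝ) → ℝ}, IsSemialgebraicFunOn ℚ W T → IsSemialgebraicFunOn ℚ W Y → IsSemialgebraicFunOn ℚ W fun z => gd b (T z) (Y z)) ∧
    (∀ {d : ℕ} {W : Set (Fin d → ℝ)}, IsSemialgebraic ℚ W → ∀ (a : Fin (m + 2)) {T Y : (Fin d → ℝ) → ℝ}, IsSemialgebraicFunOn ℚ W T → IsSemialgebraicFunOn ℚ W Y → IsSemialgebraicFunOn ℚ W fun z => dd a (T z) (Y z)) ∧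
    (∀ {d : ℕ} {W : Set (Fin d → ℝ)}, IsSemialgebraic ℚ W → ∀ {n : ℕ} (U : Fin n → Fin (m + 2)) {X : (Fin d → ℝ) → Fin n → ℝ} {P Q : (Fin d → ℝ) → ℝ}, (∀ i, IsSemialgebraicFunOn ℚ W fun z => X z i) → IsSemialgebraicFunOn ℚ W P → IsSemialgebraicFunOn ℚ W Q → IsSemialgebraicFunOn ℚ W fun z => Ht U (X z) (P z) (Q z)) ∧
    (∀ {d : ℕ} {W : Set (Fin d → ℝ)}, IsSemialgebraic ℚ W → ∀ {n : ℕ} (V : Fin n → Fin (m + 2)) {Y : (Fin d → ℝ) → Fin n → ℝ} {P Q : (Fin d → ℝ) → ℝ}, (∀ i, IsSemialgebraicFunOn ℚ W fun z => Y z i) → IsSemialgebraicFunOn ℚ W P → IsSemialgebraicFunOn ℚ W Q → IsSemialgebraicFunOn ℚ W fun z => Vt V (Y z) (P z) (Q z)) ∧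
    (∀ {d : ℕ} {W : Set (Fin d → ℝ)}, IsSemialgebraic ℚ W → ∀ {n : ℕ} (U : Fin n → Fin (m + 2)) {X : (Fin d → ℝ) → Fin n → ℝ} {P Q : (Fin d → ℝ) → ℝ}, (∀ i, IsSemialgebraicFunOn ℚ W fun z => X z i) → IsSemialgebraicFunOn ℚ W P → IsSemialgebraicFunOn ℚ W Q → IsSemialgebraicFunOn ℚ W fun z => dHt U (X z) (P z) (Q z)) ∧
    (∀ {d : ℕ} {W : Set (Fin d → ℝ)}, IsSemialgebraic ℚ W → ∀ {n : ℕ} (V : Fin n → Fin (m + 2)) {Y : (Fin d → ℝ) → Fin n → ℝ} {P Q : (Fin d → ℝ) → ℝ}, (∀ i, IsSemialgebraicFunOn ℚ W fun z => Y z i) → IsSemialgebraicFunOn ℚ W P → IsSemialgebraicFunOn ℚ W Q → IsSemialgebraicFunOn ℚ W fun z => dVt V (Y z) (P z) (Q z)) ∧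
    (∃ C : ℝ, ∀ (a : Fin (m + 2)) (ξ η : ℝ), 0 ≤ ξ → ξ ≤ (α : ℝ) → 0 ≤ η → η ≤ (β : ℝ) → (a ≠ ℓ → |fd a ξ η| ≤ C) ∧ (a ≠ ℓ' → |gd a ξ η| ≤ C) ∧ |dd a ξ η| ≤ C ∧ (∀ η' : ℝ, 0 ≤ η' → η' ≤ (β : ℝ) → |fd a ξ η - fd a ξ η'| ≤ C * |η - η'|) ∧ (∀ ξ' : ℝ, 0 ≤ ξ' → ξ' ≤ (α : ℝ) → |gd a ξ η - gd a ξ' η| ≤ C * |ξ - ξ'|)) ∧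
    (∀ k : ℕ, ∃ C : ℝ, ∀ (U : Fin k → Fin (m + 2)) (x : Fin k → ℝ) (ξ η : ℝ), (∀ i, 0 ≤ x i ∧ x i ≤ 1) → 0 ≤ ξ → ξ ≤ (α : ℝ) → 0 ≤ η → η ≤ (β : ℝ) → |Ht U x ξ η| ≤ C ∧ |dHt U x ξ η| ≤ C ∧ (0 < k → |Ht U x ξ η| ≤ C * ξ) ∧ (∀ η' : ℝ, 0 ≤ η' → η' ≤ (β : ℝ) → |Ht U x ξ η - Ht U x ξ η'| ≤ C * ξ * |η - η'|)) ∧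
    (∀ l : ℕ, ∃ C : ℝ, ∀ (V : Fin l → Fin (m + 2)) (y : Fin l → ℝ) (ξ η : ℝ), (∀ i, 0 ≤ y i ∧ y i ≤ 1) → 0 ≤ ξ → ξ ≤ (α : ℝ) → 0 ≤ η → η ≤ (β : ℝ) → |Vt V y ξ η| ≤ C ∧ |dVt V y ξ η| ≤ C ∧ (0 < l → |Vt V y ξ η| ≤ C * η) ∧ (∀ ξ' : ℝ, 0 ≤ ξ' → ξ' ≤ (α : ℝ) → |Vt V y ξ η - Vt V y ξ' η| ≤ C * η * |ξ - ξ'|)))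

/-! ### Tools for the induced data of Step A -/

/-- Composition of a `ℚ`-semialgebraic function with a coordinate projection is `ℚ`-semialgebraic
(private copy of `qe_comp_proj` of `…CornerEngineExistEAux.lean`, to keep this file independent of
it). [cite: BochnakCosteRoy1998, Prop. 2.2.6] -/
private theorem comp_proj {d₁ d₂ : ℕ} (π : Fin d₁ → Fin d₂) {D : Set (Fin d₁ → ℝ)} {g : (Fin d₁ → ℝ) → ℝ}
    (hg : IsSemialgebraicFunOn ℚ D g) {S : Set (Fin d₂ → ℝ)} (hS : IsSemialgebraic ℚ S)
    (hSD : ∀ z ∈ S, (fun i => z (π i)) ∈ D) :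
    IsSemialgebraicFunOn ℚ S (fun z => g (fun i => z (π i))) := by
  rw [isSemialgebraicFunOn_iff] at hg ⊢
  let π' : Fin (d₁ + 1) → Fin (d₂ + 1) := Fin.lastCases (Fin.last d₂) (fun i => Fin.castSucc (π i))
  convert hS.setOf_init_mem.inter (hg.preimage_comp π') using 1
  ext v
  have h1 : Fin.init (v ∘ π') = fun i => Fin.init v (π i) := by ext i; simp [π', Fin.init]
  have h2 : (v ∘ π') (Fin.last d₁) = v (Fin.last d₂) := by simp [π']
  simp only [mem_setOf_eq, mem_inter_iff, mem_preimage, h1, h2]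
  exact ⟨fun h => ⟨h.1, hSD _ h.1, h.2⟩, fun h => ⟨h.1, h.2.2⟩⟩

/-- `Fin.init` of a point of `[0,1]^{e+1}` lies in `[0,1]^e`, and its last coordinate in `[0,1]`.
[folklore] -/
theorem init_mem_cube {e : ℕ} {θ' : Fin (e + 1) → ℝ} (h : θ' ∈ KZ.cube (e + 1)) :
    Fin.init θ' ∈ KZ.cube e ∧ 0 ≤ θ' (Fin.last e) ∧ θ' (Fin.last e) ≤ 1 :=
  ⟨KZ.mem_cube.2 fun i => KZ.mem_cube.1 h (Fin.castSucc i), (KZ.mem_cube.1 h _).1, (KZ.mem_cube.1 h _).2⟩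

/-- A semialgebraic function of `Fin.init θ'` is a semialgebraic function of `θ'`.
[cite: BochnakCosteRoy1998, Prop. 2.2.6] -/
theorem sa_init {e : ℕ} {φ : (Fin e → ℝ) → ℝ} (hφ : IsSemialgebraicFunOn ℚ (KZ.cube e) φ) :
    IsSemialgebraicFunOn ℚ (KZ.cube (e + 1)) fun θ' => φ (Fin.init θ') :=
  comp_proj Fin.castSucc hφ KZ.isSemialgebraic_cube fun _ h => (init_mem_cube h).1

/-- The coordinates are semialgebraic functions on the cube. [cite: BochnakCosteRoy1998, §2.2] -/
theorem sa_coord_cube {d : ℕ} (i : Fin d) : IsSemialgebraicFunOn ℚ (KZ.cube d) fun θ => θ i :=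
  (isSemialgebraicFunOn_aeval KZ.isSemialgebraic_cube (MvPolynomial.X i : MvPolynomial _ ℚ)).congr
    fun z _ => by simp

include H in
/-- **`|fd a (t, y)| · t` is bounded on the rectangle** (`fd ℓ (t, y) = 1/t` for the regularised
letter, the other densities are bounded). [folklore] -/
theorem abs_fd_mul_le : ∃ Kf : ℝ, 0 ≤ Kf ∧ ∀ (a : Fin (m + 2)) (t y : ℝ), 0 ≤ t → t ≤ (α : ℝ) →
    0 ≤ y → y ≤ (β : ℝ) → |fd a t y| * t ≤ Kf := by
  obtain ⟨_, _, _, _, _, _, _, _, _, _, _, _, _, _, _, _, _, hfd_reg, _, _, _, _, _, _, _, _, _, _, _, _, _, _, _,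
    _, _, _, _, _, _, _, _, _, _, _, hbd_letters, -⟩ := H
  obtain ⟨Cb, hCb⟩ := hbd_letters
  refine ⟨|Cb| * |(α : ℝ)| + 1, by positivity, fun a t y ht0 htα hy0 hyβ => ?_⟩
  by_cases ha : a = ℓ
  · rw [ha, hfd_reg]
    have h1 : |1 / t| * t ≤ 1 := by
      rcases eq_or_ne t 0 with rfl | ht
      · simp
      · rw [abs_of_nonneg (one_div_nonneg.2 ht0), one_div_mul_cancel ht]
    exact h1.trans (le_add_of_nonneg_left (by positivity))
  · calc |fd a t y| * t ≤ |Cb| * |(α : ℝ)| :=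
        mul_le_mul (((hCb a t y ht0 htα hy0 hyβ).1 ha).trans (le_abs_self _)) (htα.trans (le_abs_self _))
          ht0 (abs_nonneg _)
      _ ≤ |Cb| * |(α : ℝ)| + 1 := le_add_of_nonneg_right zero_le_one

include H in
/-- **`|gd b (x, s)| · s` is bounded on the rectangle** (`gd ℓ' (x, s) = 1/s`). [folklore] -/
theorem abs_gd_mul_le : ∃ Kg : ℝ, 0 ≤ Kg ∧ ∀ (b : Fin (m + 2)) (x s : ℝ), 0 ≤ x → x ≤ (α : ℝ) →
    0 ≤ s → s ≤ (β : ℝ) → |gd b x s| * s ≤ Kg := by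
  obtain ⟨_, _, _, _, _, _, _, _, _, _, _, _, _, _, _, _, _, _, hgd_reg, _, _, _, _, _, _, _, _, _, _, _, _, _, _,
    _, _, _, _, _, _, _, _, _, _, _, hbd_letters, -⟩ := H
  obtain ⟨Cb, hCb⟩ := hbd_letters
  refine ⟨|Cb| * |(β : ℝ)| + 1, by positivity, fun b x s hx0 hxα hs0 hsβ => ?_⟩
  by_cases hb : b = ℓ'
  · rw [hb, hgd_reg]
    have h1 : |1 / s| * s ≤ 1 := by
      rcases eq_or_ne s 0 with rfl | hs
      · simp
      · rw [abs_of_nonneg (one_div_nonneg.2 hs0), one_div_mul_cancel hs]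
    exact h1.trans (le_add_of_nonneg_left (by positivity))
  · calc |gd b x s| * s ≤ |Cb| * |(β : ℝ)| :=
        mul_le_mul (((hCb b x s hx0 hxα hs0 hsβ).2.1 hb).trans (le_abs_self _)) (hsβ.trans (le_abs_self _))
          hs0 (abs_nonneg _)
      _ ≤ |Cb| * |(β : ℝ)| + 1 := le_add_of_nonneg_right zero_le_one

/-- The weight `ρ₂ = σ Ξ Η (θ₀)` at level `e + 2` is bounded by the admissibility constant (which is
therefore nonnegative). [folklore] -/
theorem abs_rho2_le {e : ℕ} {Ξ Η σ : (Fin e → ℝ) → ℝ}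
    (hΞΗ : ∀ θ ∈ KZ.cube e, 0 ≤ Ξ θ ∧ Ξ θ ≤ (α : ℝ) ∧ 0 ≤ Η θ ∧ Η θ ≤ (β : ℝ)) {C₀ : ℝ}
    (hC₀ : ∀ θ ∈ KZ.cube e, |σ θ| * Ξ θ * Η θ ≤ C₀) (ρ₂ : (Fin (e + 2) → ℝ) → ℝ)
    (hρ₂ : ∀ θ'', ρ₂ θ'' = σ (Fin.init (Fin.init θ'')) * Ξ (Fin.init (Fin.init θ'')) * Η (Fin.init (Fin.init θ'')))
    {θ'' : Fin (e + 2) → ℝ} (hθ'' : θ'' ∈ KZ.cube (e + 2)) : |ρ₂ θ''| ≤ C₀ ∧ 0 ≤ C₀ := by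
  have h0 := (init_mem_cube (init_mem_cube hθ'').1).1
  obtain ⟨hΞ0, -, hΗ0, -⟩ := hΞΗ _ h0
  have h := hC₀ _ h0
  rw [hρ₂, abs_mul, abs_mul, abs_of_nonneg hΞ0, abs_of_nonneg hΗ0]
  exact ⟨h, le_trans (by positivity) h⟩

/-! ### Admissibility of the new data -/

include H in
/-- **Admissibility of the new data of Step A** (levels `e + 1` and `e + 2`): semialgebraicity,
ranges, normalisation and the admissibility bounds of the weights `σ_a = σ Ξ fd_a(Ξ₁, Η₁)`,
`ρ₂ dd_c(Ξ₂, Η₂)`, `ρ₂ fd_a gd_b (Ξ₂, Η₂)`. [folklore] -/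
theorem exists_stepA_adm (μ : (DrinfeldKohnoTrunc ℚ (Fin 4) N) →ₗ[ℚ] ℚ) (e : ℕ) (Ξ Η σ : (Fin e → ℝ) → ℝ)
    (hΞΗ : ∀ θ ∈ KZ.cube e, 0 ≤ Ξ θ ∧ Ξ θ ≤ (α : ℝ) ∧ 0 ≤ Η θ ∧ Η θ ≤ (β : ℝ))
    (hsaΞ : IsSemialgebraicFunOn ℚ (KZ.cube e) Ξ) (hsaΗ : IsSemialgebraicFunOn ℚ (KZ.cube e) Η)
    (hsaσ : IsSemialgebraicFunOn ℚ (KZ.cube e) σ) (hb : ∃ C : ℝ, ∀ θ ∈ KZ.cube e, |σ θ| * Ξ θ * Η θ ≤ C)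
    (hσ0 : ∀ θ ∈ KZ.cube e, Ξ θ = 0 ∨ Η θ = 0 → σ θ = 0)
    (Ξ₁ Η₁ ρ : (Fin (e + 1) → ℝ) → ℝ) (σw : Fin (m + 2) → (Fin (e + 1) → ℝ) → ℝ)
    (hΞ₁ : ∀ θ', Ξ₁ θ' = Ξ (Fin.init θ') * θ' (Fin.last e)) (hΗ₁ : ∀ θ', Η₁ θ' = Η (Fin.init θ'))
    (hρ : ∀ θ', ρ θ' = σ (Fin.init θ') * Ξ (Fin.init θ'))
    (hσw : ∀ a θ', σw a θ' = ρ θ' * fd a (Ξ₁ θ') (Η₁ θ'))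
    (Ξ₂ Η₂ ρ₂ : (Fin (e + 2) → ℝ) → ℝ)
    (hΞ₂ : ∀ θ'', Ξ₂ θ'' = Ξ (Fin.init (Fin.init θ'')) * θ'' (Fin.castSucc (Fin.last e)))
    (hΗ₂ : ∀ θ'', Η₂ θ'' = Η (Fin.init (Fin.init θ'')) * θ'' (Fin.last (e + 1)))
    (hρ₂ : ∀ θ'', ρ₂ θ'' = σ (Fin.init (Fin.init θ'')) * Ξ (Fin.init (Fin.init θ'')) * Η (Fin.init (Fin.init θ'')))
    (k l : ℕ) :
    (IsSemialgebraicFunOn ℚ (KZ.cube (e + 1)) Ξ₁ ∧ IsSemialgebraicFunOn ℚ (KZ.cube (e + 1)) Η₁ ∧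
      (∀ a, IsSemialgebraicFunOn ℚ (KZ.cube (e + 1)) (σw a)) ∧
      (∀ θ' ∈ KZ.cube (e + 1), 0 ≤ Ξ₁ θ' ∧ Ξ₁ θ' ≤ (α : ℝ) ∧ 0 ≤ Η₁ θ' ∧ Η₁ θ' ≤ (β : ℝ)) ∧
      (∀ a, ∃ C : ℝ, ∀ θ' ∈ KZ.cube (e + 1), |σw a θ'| * Ξ₁ θ' * Η₁ θ' ≤ C)) ∧
    (IsSemialgebraicFunOn ℚ (KZ.cube (e + 2)) Ξ₂ ∧ IsSemialgebraicFunOn ℚ (KZ.cube (e + 2)) Η₂ ∧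
      IsSemialgebraicFunOn ℚ (KZ.cube (e + 2)) ρ₂ ∧
      (∀ θ'' ∈ KZ.cube (e + 2), 0 ≤ Ξ₂ θ'' ∧ Ξ₂ θ'' ≤ (α : ℝ) ∧ 0 ≤ Η₂ θ'' ∧ Η₂ θ'' ≤ (β : ℝ)) ∧
      (∀ c, IsSemialgebraicFunOn ℚ (KZ.cube (e + 2)) (fun θ'' => ρ₂ θ'' * dd c (Ξ₂ θ'') (Η₂ θ'')) ∧
        ∃ C : ℝ, ∀ θ'' ∈ KZ.cube (e + 2), |ρ₂ θ'' * dd c (Ξ₂ θ'') (Η₂ θ'')| * Ξ₂ θ'' * Η₂ θ'' ≤ C) ∧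
      (∀ a b, IsSemialgebraicFunOn ℚ (KZ.cube (e + 2)) (fun θ'' => ρ₂ θ'' * (fd a (Ξ₂ θ'') (Η₂ θ'') * gd b (Ξ₂ θ'') (Η₂ θ''))) ∧
        ∃ C : ℝ, ∀ θ'' ∈ KZ.cube (e + 2), |ρ₂ θ'' * (fd a (Ξ₂ θ'') (Η₂ θ'') * gd b (Ξ₂ θ'') (Η₂ θ''))| * Ξ₂ θ'' * Η₂ θ'' ≤ C)) := by
  -- `μ`, `hσ0`, `k`, `l` belong to the frozen interface of Step A but are not needed here
  have _ := μ; have _ := hσ0; have _ := k; have _ := l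
  obtain ⟨Kf, hKf0, hKf⟩ := abs_fd_mul_le H
  obtain ⟨Kg, _, hKg⟩ := abs_gd_mul_le H
  obtain ⟨_, _, _, _, _, _, _, _, _, _, _, _, _, _, _, _, _, _, _, _, _, _, _, _, _, _, _, _, _, _, _, _, _, _, _, _,
    _, hsa_fd, hsa_gd, hsa_dd, _, _, _, _, hbd_letters, -⟩ := H
  obtain ⟨Cb, hCb⟩ := hbd_letters
  obtain ⟨C₀, hC₀⟩ := hb
  have hW := fun d => KZ.isSemialgebraic_cube (n := d)
  -- semialgebraicity of the induced data
  have saΞ₁ : IsSemialgebraicFunOn ℚ (KZ.cube (e + 1)) Ξ₁ :=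
    ((sa_init hsaΞ).fun_mul (sa_coord_cube (Fin.last e))).congr fun θ' _ => (hΞ₁ θ').symm
  have saΗ₁ : IsSemialgebraicFunOn ℚ (KZ.cube (e + 1)) Η₁ := (sa_init hsaΗ).congr fun θ' _ => (hΗ₁ θ').symm
  have saρ : IsSemialgebraicFunOn ℚ (KZ.cube (e + 1)) ρ :=
    ((sa_init hsaσ).fun_mul (sa_init hsaΞ)).congr fun θ' _ => (hρ θ').symm
  have saΞ₂ : IsSemialgebraicFunOn ℚ (KZ.cube (e + 2)) Ξ₂ :=
    ((sa_init (sa_init hsaΞ)).fun_mul (sa_coord_cube (Fin.castSucc (Fin.last e)))).congr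
      fun θ'' _ => (hΞ₂ θ'').symm
  have saΗ₂ : IsSemialgebraicFunOn ℚ (KZ.cube (e + 2)) Η₂ :=
    ((sa_init (sa_init hsaΗ)).fun_mul (sa_coord_cube (Fin.last (e + 1)))).congr fun θ'' _ => (hΗ₂ θ'').symm
  have saρ₂ : IsSemialgebraicFunOn ℚ (KZ.cube (e + 2)) ρ₂ :=
    (((sa_init (sa_init hsaσ)).fun_mul (sa_init (sa_init hsaΞ))).fun_mul (sa_init (sa_init hsaΗ))).congr
      fun θ'' _ => (hρ₂ θ'').symm
  -- ranges of the induced dilations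
  have hr₁ : ∀ θ' ∈ KZ.cube (e + 1), 0 ≤ Ξ₁ θ' ∧ Ξ₁ θ' ≤ (α : ℝ) ∧ 0 ≤ Η₁ θ' ∧ Η₁ θ' ≤ (β : ℝ) := by
    intro θ' hθ'
    obtain ⟨h0, ht0, ht1⟩ := init_mem_cube hθ'
    obtain ⟨hΞ0, hΞα, hΗ0, hΗβ⟩ := hΞΗ _ h0
    rw [hΞ₁, hΗ₁]
    exact ⟨mul_nonneg hΞ0 ht0, (mul_le_of_le_one_right hΞ0 ht1).trans hΞα, hΗ0, hΗβ⟩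
  have hr₂ : ∀ θ'' ∈ KZ.cube (e + 2), 0 ≤ Ξ₂ θ'' ∧ Ξ₂ θ'' ≤ (α : ℝ) ∧ 0 ≤ Η₂ θ'' ∧ Η₂ θ'' ≤ (β : ℝ) := by
    intro θ'' hθ''
    obtain ⟨h1, hs'0, hs'1⟩ := init_mem_cube hθ''
    obtain ⟨h0, hs0, hs1⟩ := init_mem_cube h1
    obtain ⟨hΞ0, hΞα, hΗ0, hΗβ⟩ := hΞΗ _ h0
    rw [hΞ₂, hΗ₂]
    exact ⟨mul_nonneg hΞ0 hs0, (mul_le_of_le_one_right hΞ0 hs1).trans hΞα, mul_nonneg hΗ0 hs'0,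
      (mul_le_of_le_one_right hΗ0 hs'1).trans hΗβ⟩
  refine ⟨⟨saΞ₁, saΗ₁, fun a => ?_, hr₁, fun a => ⟨C₀ * Kf, fun θ' hθ' => ?_⟩⟩,
    ⟨saΞ₂, saΗ₂, saρ₂, hr₂, fun c => ⟨saρ₂.fun_mul (hsa_dd (hW _) c saΞ₂ saΗ₂),
      ⟨C₀ * (|Cb| * (|(α : ℝ)| * |(β : ℝ)|)), fun θ'' hθ'' => ?_⟩⟩,
      fun a b => ⟨saρ₂.fun_mul ((hsa_fd (hW _) a saΞ₂ saΗ₂).fun_mul (hsa_gd (hW _) b saΞ₂ saΗ₂)),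
        ⟨C₀ * (Kf * Kg), fun θ'' hθ'' => ?_⟩⟩⟩⟩
  · -- semialgebraicity of the weights `σ_a`
    exact (saρ.fun_mul (hsa_fd (hW _) a saΞ₁ saΗ₁)).congr fun θ' _ => (hσw a θ').symm
  · -- the admissibility bound at level `e + 1`: `|σ_a| Ξ₁ Η₁ = (|σ| Ξ Η)(θ₀) · |fd a (Ξ₁, Η₁)| Ξ₁`
    obtain ⟨h0, ht0, ht1⟩ := init_mem_cube hθ'
    obtain ⟨hΞ0, hΞα, hΗ0, hΗβ⟩ := hΞΗ _ h0
    obtain ⟨h10, h1α, -, -⟩ := hr₁ θ' hθ'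
    have hb0 := hC₀ _ h0
    rw [hσw, hρ, hΗ₁, abs_mul, abs_mul, abs_of_nonneg hΞ0]
    calc |σ (Fin.init θ')| * Ξ (Fin.init θ') * |fd a (Ξ₁ θ') (Η (Fin.init θ'))| * Ξ₁ θ' * Η (Fin.init θ')
        = |σ (Fin.init θ')| * Ξ (Fin.init θ') * Η (Fin.init θ') *
            (|fd a (Ξ₁ θ') (Η (Fin.init θ'))| * Ξ₁ θ') := by ring
      _ ≤ C₀ * Kf :=
        mul_le_mul hb0 (hKf a _ _ h10 h1α hΗ0 hΗβ) (by positivity) (le_trans (by positivity) hb0)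
  · -- the `dd`-weights at level `e + 2`
    obtain ⟨hρa, hC0⟩ := abs_rho2_le hΞΗ hC₀ ρ₂ hρ₂ hθ''
    obtain ⟨h20, h2α, h2η0, h2β⟩ := hr₂ θ'' hθ''
    have hdd := (hCb c _ _ h20 h2α h2η0 h2β).2.2.1
    rw [abs_mul]
    calc |ρ₂ θ''| * |dd c (Ξ₂ θ'') (Η₂ θ'')| * Ξ₂ θ'' * Η₂ θ''
        = |ρ₂ θ''| * (|dd c (Ξ₂ θ'') (Η₂ θ'')| * (Ξ₂ θ'' * Η₂ θ'')) := by ring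
      _ ≤ C₀ * (|Cb| * (|(α : ℝ)| * |(β : ℝ)|)) :=
        mul_le_mul hρa (mul_le_mul (hdd.trans (le_abs_self _))
          (mul_le_mul (h2α.trans (le_abs_self _)) (h2β.trans (le_abs_self _)) h2η0 (abs_nonneg _))
          (by positivity) (abs_nonneg _)) (by positivity) hC0
  · -- the `fd gd`-weights at level `e + 2`
    obtain ⟨hρa, hC0⟩ := abs_rho2_le hΞΗ hC₀ ρ₂ hρ₂ hθ''
    obtain ⟨h20, h2α, h2η0, h2β⟩ := hr₂ θ'' hθ''
    rw [abs_mul, abs_mul]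
    calc |ρ₂ θ''| * (|fd a (Ξ₂ θ'') (Η₂ θ'')| * |gd b (Ξ₂ θ'') (Η₂ θ'')|) * Ξ₂ θ'' * Η₂ θ''
        = |ρ₂ θ''| * ((|fd a (Ξ₂ θ'') (Η₂ θ'')| * Ξ₂ θ'') * (|gd b (Ξ₂ θ'') (Η₂ θ'')| * Η₂ θ'')) := by ring
      _ ≤ C₀ * (Kf * Kg) :=
        mul_le_mul hρa (mul_le_mul (hKf a _ _ h20 h2α h2η0 h2β) (hKg b _ _ h20 h2α h2η0 h2β)
          (by positivity) hKf0) (by positivity) hC0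

end AbstractEngine

/-- **Hook `cornerEngineExistAdm_init_mem_cube`** (registered form of `init_mem_cube`): `Fin.init`
of a point of `[0,1]^{e+1}` lies in `[0,1]^e` and its last coordinate in `[0,1]`. [folklore] -/
theorem cornerEngineExistAdm_init_mem_cube : ∀ (e : ℕ) (θ' : Fin (e + 1) → ℝ), θ' ∈ Literature.NumberTheory.Transcendental.KZ.cube (e + 1) → Fin.init θ' ∈ Literature.NumberTheory.Transcendental.KZ.cube e ∧ 0 ≤ θ' (Fin.last e) ∧ θ' (Fin.last e) ≤ 1 :=
  fun _ _ h => init_mem_cube h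

end Summit.KontsevichZagierPeriods.FurushoPentagon.PentagonInKZ
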